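import Mathlib
import Summits.Ventures.HodgeRepro2.T5MeasureSupOnClopens
import Summits.Ventures.HodgeRepro2.T5AmiceIsometry

/-!
# T5MeasureSupAmice — the norm-form μ-invariant of an `𝒪`-valued measure on `ℤ_p` is the sup norm of `f_m`

Cell pub-hodge-repro2, Tier 5 support (seat p7; route/T5-CHECK-G-p7.md §3 S4 / S5). T5MeasureSupOnClopens
(p400050) carries S4's «μ = inf over opens» in the NORM vocabulary for a measure with values in any integral
ultrametric `R` (`‖r‖ ≤ 1`, e.g. `W`): `sSup (clopenValues m) = sSup (allValues m)` — the supremum of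
`‖m(1_U)‖` over clopen `U` equals the supremum of `‖m φ‖` over all `φ`, and `μ(m) = −log_p` of it.
T5AmiceIsometry (p401177) identifies the least bound of `m` with `coeffSup m = sup_n ‖coeff_n f_m‖`. This
file joins the two on `X = ℤ_p`:

* `sSup_allValues_eq_coeffSup`: `sSup (allValues m) = coeffSup m` for an integral `R`;
* `sSup_clopenValues_eq_coeffSup`: hence `sSup (clopenValues m) = sup_n ‖m(x choose n)‖` — S4's norm-form
  μ-invariant of the measure IS the sup norm of its power series, for `W`-valued measures (T5MuInvariantAmice
  did the `ℤ_p`-valued case in the valuation vocabulary).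

Mathlib + own T5MeasureSupOnClopens, T5AmiceIsometry (hence T5AmiceTransform) only.
-/

namespace Summit.Ventures.HodgeRepro2.T5MeasureSupAmice

open PadicInt Filter Topology
open Summit.Ventures.HodgeRepro2.T5MeasureSupOnClopens
open Summit.Ventures.HodgeRepro2.T5AmiceTransform
open Summit.Ventures.HodgeRepro2.T5AmiceIsometry

variable {p : ℕ} [hp : Fact p.Prime]
variable {R : Type*} [NormedCommRing R] [Algebra ℤ_[p] R] [IsBoundedSMul ℤ_[p] R]
  [IsUltrametricDist R] [CompleteSpace R]

omit [IsUltrametricDist R] [CompleteSpace R] in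
/-- Every moment norm `‖m(x choose n)‖ = ‖coeff_n f_m‖` is a value of `m`. -/
theorem norm_coeff_mem_allValues (m : C(ℤ_[p], R) →ₗ[R] R) (n : ℕ) :
    ‖PowerSeries.coeff n (amice m)‖ ∈ allValues m :=
  ⟨mahlerTerm (1 : R) n, by rw [coeff_amice]⟩

omit [IsUltrametricDist R] [CompleteSpace R] in
/-- `coeffSup m ≤ sSup (allValues m)` (bounded `m`, integral `R`). -/
theorem coeffSup_le_sSup_allValues (hR : ∀ r : R, ‖r‖ ≤ 1) (m : C(ℤ_[p], R) →ₗ[R] R) {C : ℝ}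
    (hC : 0 ≤ C) (hb : ∀ φ, ‖m φ‖ ≤ C * ‖φ‖) : coeffSup m ≤ sSup (allValues m) :=
  coeffSup_le m fun n => le_csSup (bddAbove_allValues hR m hC hb) (norm_coeff_mem_allValues m n)

/-- `sSup (allValues m) ≤ coeffSup m` (integral `R`: `‖φ‖ ≤ 1`, so `‖m φ‖ ≤ coeffSup m · ‖φ‖ ≤ coeffSup m`). -/
theorem sSup_allValues_le_coeffSup (hR : ∀ r : R, ‖r‖ ≤ 1) (m : C(ℤ_[p], R) →ₗ[R] R) {C : ℝ}
    (hb : ∀ φ, ‖m φ‖ ≤ C * ‖φ‖) : sSup (allValues m) ≤ coeffSup m := by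
  have hne : (allValues m).Nonempty := ⟨_, norm_coeff_mem_allValues m 0⟩
  refine csSup_le hne ?_
  rintro _ ⟨φ, rfl⟩
  have hφ : ‖φ‖ ≤ 1 := (ContinuousMap.norm_le φ zero_le_one).mpr fun x => hR (φ x)
  calc ‖m φ‖ ≤ coeffSup m * ‖φ‖ := norm_map_le_coeffSup_mul m (continuous_of_bound m C hb) hb φ
    _ ≤ coeffSup m * 1 := by gcongr; exact coeffSup_nonneg m
    _ = coeffSup m := mul_one _

/-- THE SUPREMUM OF THE VALUES OF `m` IS THE SUP NORM OF `f_m`: `sSup (allValues m) = coeffSup m`. -/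
theorem sSup_allValues_eq_coeffSup (hR : ∀ r : R, ‖r‖ ≤ 1) (m : C(ℤ_[p], R) →ₗ[R] R) {C : ℝ}
    (hC : 0 ≤ C) (hb : ∀ φ, ‖m φ‖ ≤ C * ‖φ‖) : sSup (allValues m) = coeffSup m :=
  le_antisymm (sSup_allValues_le_coeffSup hR m hb) (coeffSup_le_sSup_allValues hR m hC hb)

/-- S4's norm-form μ-invariant («sup over opens» of `‖m(1_U)‖`) is the sup norm of the power series:
`sSup (clopenValues m) = sup_n ‖coeff_n f_m‖`, for an `𝒪`-valued measure on `ℤ_p`. -/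
theorem sSup_clopenValues_eq_coeffSup (hR : ∀ r : R, ‖r‖ ≤ 1) (m : C(ℤ_[p], R) →ₗ[R] R) {C : ℝ}
    (hC : 0 ≤ C) (hb : ∀ φ, ‖m φ‖ ≤ C * ‖φ‖) : sSup (clopenValues m) = coeffSup m := by
  rw [← sSup_allValues_eq_sSup_clopenValues hR m hC hb, sSup_allValues_eq_coeffSup hR m hC hb]

/-- `sup_U ‖m(1_U)‖ = 0 ⟺ m = 0` (bounded `m`, integral `R`). -/
theorem sSup_clopenValues_eq_zero_iff (hR : ∀ r : R, ‖r‖ ≤ 1) (m : C(ℤ_[p], R) →ₗ[R] R) {C : ℝ}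
    (hC : 0 ≤ C) (hb : ∀ φ, ‖m φ‖ ≤ C * ‖φ‖) : sSup (clopenValues m) = 0 ↔ m = 0 := by
  rw [sSup_clopenValues_eq_coeffSup hR m hC hb]
  exact coeffSup_eq_zero_iff m (continuous_of_bound m C hb) hb

/-- The values of `m` on clopen indicators are bounded by the sup norm of `f_m`. -/
theorem norm_map_indicatorCM_le_coeffSup (hR : ∀ r : R, ‖r‖ ≤ 1) (m : C(ℤ_[p], R) →ₗ[R] R) {C : ℝ}
    (hC : 0 ≤ C) (hb : ∀ φ, ‖m φ‖ ≤ C * ‖φ‖) {U : Set ℤ_[p]} (hU : IsClopen U) :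
    ‖m (indicatorCM U)‖ ≤ coeffSup m := by
  rw [← sSup_clopenValues_eq_coeffSup hR m hC hb]
  exact le_csSup (bddAbove_clopenValues hR m hC hb) ⟨U, hU, rfl⟩

end Summit.Ventures.HodgeRepro2.T5MeasureSupAmice
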